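import Literature.AlgebraicGeometry.Frobenioids.ArchimedeanFSM
import Literature.AlgebraicGeometry.Frobenioids.ElementaryPreFrobenioid
import HarnessLib

/-!
# Frobenioids II, Proposition 3.4 (v)/(vi): the per-tower predicates are NOT tautologies of a tower
# (abc-iut cell, layer L1, node `FrdII:Prop3.4(vi)`; FACT-LIST rows F-0819 `Tower.PropV`,
# F-0823 `Tower.PropVI_FSMI`, F-0824 `Tower.PropVI_irreducible` — universal closures)

Mochizuki, *The geometry of Frobenioids II: poly-Frobenioids*, Kyushu J. Math. **62** (2008)
401–460, §3, Proposition 3.4 (v), (vi) p. 30 [cite: MochizukiFrdII2008, Prop 3.4 (vi) p.30].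

PROOF-ONLY file (nothing is defined). The cell states each item of Prop. 3.4 once as a predicate of an
ABSTRACT tower `T : ArchFrd.Tower π` (`ArchimedeanFSM.lean`) and the printed item as its conjunction
over the three NAMED towers `towerA π`, `towerN π`, `towerR π`. The FACT-LIST rows F-0819 / F-0823 /
F-0824 carry the bare predicates `Tower.PropV`, `Tower.PropVI_FSMI`, `Tower.PropVI_irreducible`, whose
universal closures quantify over EVERY tower — arbitrary categories `F`, `F₀` and arbitrary projection
functors. Recorded here, so that no seat tries to prove those closures: they are FALSE, by two-line
"towers" over the preorder categories `Fin 2`, `Fin 3` (constant base `Spec ℝ`, zero divisor monoids,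
zero sections as pre-Frobenioid structures):
* `Tower.not_forall_propVI_irreducible`, `Tower.not_forall_propVI_FSMI`: `F = Fin 2 → D = Fin 3`,
  `0 ↦ 0, 1 ↦ 2`; the arrow `0 → 1` of `Fin 2` is an FSMI-morphism, its image `0 → 2 = (0 → 1)(1 → 2)`
  is neither invertible nor irreducible;
* `Tower.not_forall_propV`: `F = Fin 3 → D = Fin 2`, `0 ↦ 0, 1 ↦ 1, 2 ↦ 1`, `F → F₀` constant; the
  reducible arrow `0 → 2` projects to the irreducible `0 → 1`, to an identity of `F₀` and to an
  identity of `D₀`, so the first projection pattern of (v) fails.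
What print asserts — the items for `F ∈ {A, N, R}` — is untouched: the instance forms at the named
towers are PROVED (`prop34_vi_irreducible`; `prop34_vi_fsmi`, files `ArchimedeanFSMIProjection*`;
`A.propV`/`N.propV`/`R.propV` under the standing hypothesis "`D` totally epimorphic", with the as-typed
failure `towerA_constReal_not_propV` over a non-totally-epimorphic base). Typed ≠ print; refuted-as-
schema ≠ refuted-in-print; no side is taken on [IUTchIII] Cor. 3.12.
-/

namespace Literature.AlgebraicGeometry.Frobenioids

open CategoryTheory

noncomputable section

namespace ArchFrd

/-! ### Arrows of the preorder categories `Fin n` -/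

/-- In a preorder category an arrow `a → b` with `b ≤ a` is an isomorphism.
[cite: MochizukiFrdI2008, §0 p.17] -/
private theorem isIso_of_ge {α : Type} [Preorder α] {a b : α} (f : a ⟶ b) (h : b ≤ a) : IsIso f :=
  ⟨⟨homOfLE h, Subsingleton.elim _ _, Subsingleton.elim _ _⟩⟩

/-- In a preorder category an isomorphism `a → b` forces `b ≤ a`. [cite: MochizukiFrdI2008, §0 p.17] -/
private theorem ge_of_isIso {α : Type} [Preorder α] {a b : α} (f : a ⟶ b) (h : IsIso f) : b ≤ a :=
  leOfHom (inv f)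

/-- The arrow `0 → 1` of `Fin 2` is irreducible: it is not invertible, and every factorization passes
through `0` or `1`. [cite: MochizukiFrdI2008, §0 p.17] -/
private theorem isIrreducibleHom_fin2 (f : (0 : Fin 2) ⟶ 1) : IsIrreducibleHom f := by
  refine ⟨fun h => absurd (ge_of_isIso f h) (by decide), fun X β α _ => ?_⟩
  by_cases hX : X ≤ 0
  · exact Or.inr (isIso_of_ge β hX)
  · refine Or.inl (isIso_of_ge α ?_)
    rw [Fin.le_def] at hX ⊢
    have := X.isLt
    simp only [Fin.val_zero, Fin.val_one] at hX ⊢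
    omega

/-- The arrow `0 → 1` of `Fin 2` is an FSMI-morphism (monic and fiberwise-surjective as every arrow of
a preorder category with a least element, and irreducible). [cite: MochizukiFrdI2008, §0 p.17] -/
private theorem isFSMI_fin2 (f : (0 : Fin 2) ⟶ 1) : IsFSMI f :=
  ⟨⟨fun _ _ => ⟨0, 𝟙 _, homOfLE (Fin.zero_le _), Subsingleton.elim _ _⟩,
    ⟨fun _ _ _ => Subsingleton.elim _ _⟩⟩, isIrreducibleHom_fin2 f⟩

/-- The arrow `0 → 2` of `Fin 3` is neither invertible nor irreducible (`0 → 2 = (0 → 1)(1 → 2)` with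
both factors non-invertible). [cite: MochizukiFrdI2008, §0 p.17] -/
private theorem not_isIso_not_isIrreducibleHom_fin3 (f : (0 : Fin 3) ⟶ 2) :
    ¬ IsIso f ∧ ¬ IsIrreducibleHom f := by
  refine ⟨fun h => absurd (ge_of_isIso f h) (by decide), fun h => ?_⟩
  rcases h.2 (homOfLE (by decide) : (0 : Fin 3) ⟶ 1) (homOfLE (by decide) : (1 : Fin 3) ⟶ 2)
      (Subsingleton.elim _ _) with h1 | h1
  · exact absurd (ge_of_isIso _ h1) (by decide)
  · exact absurd (ge_of_isIso _ h1) (by decide)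

/-- The monotone map `Fin 2 → Fin 3`, `0 ↦ 0`, `1 ↦ 2`. [cite: MochizukiFrdII2008, Prop 3.4 (vi) p.30] -/
private theorem monotone_skip : Monotone (fun i : Fin 2 => if i = 0 then (0 : Fin 3) else 2) := by
  unfold Monotone
  decide

/-- The monotone map `Fin 3 → Fin 2`, `0 ↦ 0`, `1, 2 ↦ 1`. [cite: MochizukiFrdII2008, Prop 3.4 (v) p.30] -/
private theorem monotone_collapse : Monotone (fun i : Fin 3 => if i = 0 then (0 : Fin 2) else 1) := by
  unfold Monotone
  decide

/-! ### The universal closures of the per-tower predicates are false -/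

/-- **`Tower.PropVI_irreducible` is not a property of every tower** (universal closure of FACT-LIST row
F-0824 REFUTED at object universe `0`): the tower `Fin 2 → Fin 3`, `0 ↦ 0, 1 ↦ 2` over the constant base
`Spec ℝ` has the irreducible arrow `0 → 1` projecting to `0 → 2`, which is neither invertible nor
irreducible. The instance forms at the named towers `A, N, R` hold (`prop34_vi_irreducible`).
[cite: MochizukiFrdII2008, Prop 3.4 (vi) p.30] -/
theorem Tower.not_forall_propVI_irreducible :
    ¬ ∀ (D : Type) [Category.{0} D] (π : D ⥤ D0) (T : Tower π), T.PropVI_irreducible := by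
  intro h
  let π : Fin 3 ⥤ D0 := (Functor.const _).obj D0.real
  let G : Fin 2 ⥤ Fin 3 := monotone_skip.functor
  let T : Tower π :=
    { F := Fin 2, F0 := Fin 2, toD := G, toF0 := 𝟭 _, base0 := (Functor.const _).obj D0.real,
      monoid := (zeroMonoid (Fin 3) : (Fin 3)ᵒᵖ ⥤ CommMonCat.{0}),
      str := G ⋙ ElemFrobenioid.zeroSection _,
      monoid0 := (zeroMonoid D0 : D0ᵒᵖ ⥤ CommMonCat.{0}),
      str0 := (Functor.const (Fin 2)).obj D0.real ⋙ ElemFrobenioid.zeroSection _,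
      region := fun _ => AngularRegion.isotropicOfTip 1 }
  let f : (0 : Fin 2) ⟶ 1 := homOfLE (by decide)
  have hG : ¬ IsIso (G.map f) ∧ ¬ IsIrreducibleHom (G.map f) :=
    not_isIso_not_isIrreducibleHom_fin3 (G.map f)
  rcases h (Fin 3) π T f (isIrreducibleHom_fin2 f) with h1 | h1
  · exact hG.1 h1
  · exact hG.2 h1

/-- **`Tower.PropVI_FSMI` is not a property of every tower** (universal closure of FACT-LIST row F-0823
REFUTED at object universe `0`): in the same tower `0 → 1` is an FSMI-morphism of `Fin 2` whose image
`0 → 2` in `Fin 3` is neither invertible nor an FSMI-morphism. The instance forms at the named towers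
`A, N, R` hold over every base (`prop34_vi_fsmi`, files `ArchimedeanFSMIProjection*`).
[cite: MochizukiFrdII2008, Prop 3.4 (vi) p.30] -/
theorem Tower.not_forall_propVI_FSMI :
    ¬ ∀ (D : Type) [Category.{0} D] (π : D ⥤ D0) (T : Tower π), T.PropVI_FSMI := by
  intro h
  let π : Fin 3 ⥤ D0 := (Functor.const _).obj D0.real
  let G : Fin 2 ⥤ Fin 3 := monotone_skip.functor
  let T : Tower π :=
    { F := Fin 2, F0 := Fin 2, toD := G, toF0 := 𝟭 _, base0 := (Functor.const _).obj D0.real,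
      monoid := (zeroMonoid (Fin 3) : (Fin 3)ᵒᵖ ⥤ CommMonCat.{0}),
      str := G ⋙ ElemFrobenioid.zeroSection _,
      monoid0 := (zeroMonoid D0 : D0ᵒᵖ ⥤ CommMonCat.{0}),
      str0 := (Functor.const (Fin 2)).obj D0.real ⋙ ElemFrobenioid.zeroSection _,
      region := fun _ => AngularRegion.isotropicOfTip 1 }
  let f : (0 : Fin 2) ⟶ 1 := homOfLE (by decide)
  have hG : ¬ IsIso (G.map f) ∧ ¬ IsIrreducibleHom (G.map f) :=
    not_isIso_not_isIrreducibleHom_fin3 (G.map f)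
  rcases h (Fin 3) π T f (isFSMI_fin2 f) with h1 | h1
  · exact hG.1 h1
  · exact hG.2 h1.2

/-- **`Tower.PropV` is not a property of every tower** (universal closure of FACT-LIST row F-0819
REFUTED at object universe `0`; cf. `towerA_constReal_not_propV` at universe `1` for the NAMED tower
`A` over a non-totally-epimorphic base): in the tower `Fin 3 → Fin 2`, `0 ↦ 0, 1 ↦ 1, 2 ↦ 1`, `F → F₀`
constant, over the constant base `Spec ℝ`, the reducible arrow `0 → 2` projects to the irreducible
arrow `0 → 1` of `D`, to an identity of `F₀` and to an identity of `D₀` — so the first projection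
pattern of (v) fails. The instance forms at `A, N, R` hold for `D` totally epimorphic (`A.propV`,
`N.propV`, `R.propV`). [cite: MochizukiFrdII2008, Prop 3.4 (v) p.30] -/
theorem Tower.not_forall_propV :
    ¬ ∀ (D : Type) [Category.{0} D] (π : D ⥤ D0) (T : Tower π), T.PropV := by
  intro h
  let π : Fin 2 ⥤ D0 := (Functor.const _).obj D0.real
  let G : Fin 3 ⥤ Fin 2 := monotone_collapse.functor
  let T : Tower π :=
    { F := Fin 3, F0 := Fin 2, toD := G, toF0 := (Functor.const _).obj 0,
      base0 := (Functor.const _).obj D0.real,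
      monoid := (zeroMonoid (Fin 2) : (Fin 2)ᵒᵖ ⥤ CommMonCat.{0}),
      str := G ⋙ ElemFrobenioid.zeroSection _,
      monoid0 := (zeroMonoid D0 : D0ᵒᵖ ⥤ CommMonCat.{0}),
      str0 := (Functor.const (Fin 2)).obj D0.real ⋙ ElemFrobenioid.zeroSection _,
      region := fun _ => AngularRegion.isotropicOfTip 1 }
  let f : (0 : Fin 3) ⟶ 2 := homOfLE (by decide)
  have hf : ¬ IsIrreducibleHom f := (not_isIso_not_isIrreducibleHom_fin3 f).2
  refine hf ((h (Fin 2) π T f).1 (isIrreducibleHom_fin2 (G.map f)) ?_ ?_)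
  · change IsIso (𝟙 (0 : Fin 2))
    infer_instance
  · change IsIso (π.map (G.map f))
    change IsIso (𝟙 D0.real)
    infer_instance

end ArchFrd

end

end Literature.AlgebraicGeometry.Frobenioids
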